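import Mathlib
import Summits.NavierStokesRegularity.NavierStokesRegularity.Theorems.EulerZoomLiouvillePowerGaugeEulerLiouvilleSelfSimilarBernoulliSqueezeSobolevFreeTools
import Summits.NavierStokesRegularity.NavierStokesRegularity.Theorems.EulerZoomLiouvillePowerGaugeEulerLiouvilleSelfSimilarBernoulliSqueezePressureThinTools
import HarnessLib

/-!
# «SUPER-FAST CHANNELS SQUEEZE VOLUME TOO FAST» without growth hypotheses: THE SLOW PRESSURISED SET IS SOBOLEV-THIN (rate `m = 3+3ρ`)
# (crux `EulerZoomLiouville.PowerGaugeEulerLiouville` = stmt-NavierStokesRegularity-19832, line `birth`, THE ONE STATEMENT; LEAD's RESIDUE-MEMO-19832-g12 target T3)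

Route №10 `EulerZoomLiouville` (NavierStokesRegularity); width seat ns-ezl-w5 g2.  Far out a high Bernoulli point of a class-rate profile is FAST (`‖V y‖ ≥ a‖y‖`:
Sobolev-thin with rate `3+3ρ` by the LEAD's g11 brick `Loc.volume_fastSet_inter_far_le_sobolev`, p636011 — no growth hypothesis) or SLOW AND PRESSURISED
(`‖V y‖ < a‖y‖` and `P′(y) > ε‖y‖²`, this seat's g0 pointwise `Loc.norm_ge_of_bernoulliHigh_of_pressure_le`).  THE BRICK of this file: the slow pressurised set is
Sobolev-thin too, for EVERY `C¹`… `C²` CIV (3.3) profile with the class growths — NO linear-growth hypothesis (the LEAD's `…SqueezePressureThin` p639458 and this seat's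
`…SqueezeSobolevGrowth` p640144 needed `‖V y‖ ≤ K₁(1+‖y‖)` to bound `‖W‖ = O(L)` in `‖∇P′‖ ≤ |1−γ|‖V‖ + ‖DV‖‖W‖`):

> `vol({‖U y‖ < a‖y‖ ∧ ε‖y‖² < P y} ∩ {L ≤ ‖y‖ ≤ 2L}) ≤ K L^{−3−3ρ}` for `L ≥ L₀` (`Loc.volume_slowPressureHigh_inter_shell_le_sobolev`), dyadic tail
> `Loc.volume_slowPressureHigh_inter_far_le_sobolev`.

PROOF.  GNS (`p = 2`, `p* = 6`) on the DOUBLE truncation `χ_L · φ(‖U‖²/ℓ²) · ψ(P/(εL²))` (`ℓ = 2aL`): `= 1` on the target set; on the support of the velocity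
cutoff `‖W‖ ≤ (5|γ|+4a)L` on `B_{5L}` FOR FREE, so `‖∇(Φψ)‖ ≤ α‖U‖ + β‖DU‖` (`α = κ|1−γ|/(εL²)`, `β = β₀/L`, `Loc.norm_fderiv_doubleTruncation_le`); the `A`/`E` growths give
`∫_{B_{5L}}‖∇(Φψ)‖² ≲ L^{−1−ρ}`, the support term is `≲ L^{−3−2ρ}` (growth-form `D`-Chebyshev, `Q = P + c₀` a.e.), whence `vol ≲ (L^{−1−ρ})³`.
CONSEQUENCE (`…SqueezeSobolevFreeMember`): EVERY high Bernoulli set of EVERY `C²` class-rate profile is thin with rate `3+3ρ` — no growth, no pressure clause — so the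
(C2) squeeze's only use of growth is the radial upper rate ALONG vortical high orbits (T3b).
HONEST LABEL: a brick for ONE dynamical sub-stratum of THE ONE STATEMENT.  WHAT THIS IS NOT: not NS, not E — 19832 is a crux CLASS on the MODEL lattice (E/NS strata)
and stays OPEN; NS regularity is NOT proved. [folklore; ConstantinIgnatovaVicol2026Putative §3.1.1 (3.3), §3.4.3 (3.30); Gagliardo–Nirenberg–Sobolev inequality]
-/

noncomputable section

-- flat `Theorems/<Route><Decl>…` files of one crux share the namespace of the crux (tree convention)
set_option linter.dupNamespace false

open MeasureTheory Set Filter Topology Metric Function InnerProductSpace Module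
open scoped RealInnerProductSpace NNReal ENNReal ContDiff

namespace Summit.NavierStokesRegularity.NavierStokesRegularity.Theorems.PowerGaugeEulerLiouville.Loc

open Literature.Analysis Literature.Analysis.FluidPDE

variable {γ : ℝ} {U : EuclideanSpace ℝ (Fin 3) → EuclideanSpace ℝ (Fin 3)} {P : EuclideanSpace ℝ (Fin 3) → ℝ}

/-! ### The slow pressurised set is Sobolev-thin — no growth hypothesis -/

set_option maxHeartbeats 800000 in
/-- **THE SLOW PRESSURISED SET IS SOBOLEV-THIN ON DYADIC SHELLS — no growth hypothesis.**  `(U, P)` a CIV (3.3) profile (any exponent `γ`, centre `0`) with the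
class growths `∫_{B_L}|U|² ≤ c_A L^{1−2ρ}`, `∫_{B_L}‖∇U‖² ≤ c_E L^{1−ρ}` (`L > 0`), a measurable `Q = P + c₀` a.e. with the GROWTH-FORM `D`-datum
`∫_{B_R}|Q|^{3/2} ≤ C_D R^{2−2ρ}` (`R ≥ L₁`); `−2 ≤ ρ`, `ε > 0`, `a > 0`.  Then there are `K ≥ 0`, `L₀ ≥ max 1 L₁` with
`vol({‖U y‖ < a‖y‖ ∧ ε‖y‖² < P y} ∩ {L ≤ ‖y‖ ≤ 2L}) ≤ K L^{−3−3ρ}` for all `L ≥ L₀`. [folklore; Gagliardo–Nirenberg–Sobolev inequality] -/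
theorem volume_slowPressureHigh_inter_shell_le_sobolev {ρ : ℝ} (hρ0 : -2 ≤ ρ)
    (hprof : IsSelfSimilarEulerProfile γ 0 U P)
    {cA cE : ℝ} (hcA : 0 ≤ cA) (hcE : 0 ≤ cE)
    (hA : ∀ L : ℝ, 0 < L → ∫⁻ y in ball (0 : EuclideanSpace ℝ (Fin 3)) L, ‖U y‖ₑ ^ 2 ≤ ENNReal.ofReal (cA * L ^ (1 - 2 * ρ)))
    (hE : ∀ L : ℝ, 0 < L → ∫⁻ y in ball (0 : EuclideanSpace ℝ (Fin 3)) L, ‖fderiv ℝ U y‖ₑ ^ 2 ≤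
      ENNReal.ofReal (cE * L ^ (1 - ρ)))
    {Q : EuclideanSpace ℝ (Fin 3) → ℝ} (hQm : AEStronglyMeasurable Q volume) {CD : ℝ≥0} {L₁ : ℝ}
    (hD : ∀ R : ℝ, L₁ ≤ R → ∫⁻ y in ball (0 : EuclideanSpace ℝ (Fin 3)) R, ‖Q y‖ₑ ^ (3 / 2 : ℝ) ≤
      CD * ENNReal.ofReal (R ^ (2 - 2 * ρ)))
    {c₀ : ℝ} (hc₀ : Q =ᵐ[volume] fun y => P y + c₀) {ε : ℝ} (hε : 0 < ε) {a : ℝ} (ha : 0 < a) :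
    ∃ K L₀ : ℝ, 0 ≤ K ∧ max 1 L₁ ≤ L₀ ∧ ∀ L : ℝ, L₀ ≤ L →
      volume ({y : EuclideanSpace ℝ (Fin 3) | ‖U y‖ < a * ‖y‖ ∧ ε * ‖y‖ ^ 2 < P y} ∩ {y | L ≤ ‖y‖ ∧ ‖y‖ ≤ 2 * L}) ≤
        ENNReal.ofReal (K * L ^ (-3 - 3 * ρ)) := by
  obtain ⟨M, hM0, hcut⟩ := exists_scaledCutoff
  obtain ⟨κ, hκ0, ψ, hψ1, hψ0, hψle, hψzero, hψone, hdψ⟩ := exists_unitSmoothStep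
  obtain ⟨κ', hκ'0, φ, hφ1, hφ0, hφle, hφone, hφzero, hdφ, hdφz⟩ := exists_unitSmoothBump
  have hPc : ContDiff ℝ 1 P := hprof.contDiff_pressure
  have hPcont : Continuous P := hPc.continuous
  have hU1 : ContDiff ℝ 1 U := hprof.contDiff_velocity.of_le (by norm_num)
  have hUcont : Continuous U := hU1.continuous
  have hCD0 : (0 : ℝ) ≤ CD := NNReal.coe_nonneg CD
  set Cr : ℝ := ((eLpNormLESNormFDerivOfEqInnerConst (volume : Measure (EuclideanSpace ℝ (Fin 3))) 2 : ℝ≥0) : ℝ) with hCr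
  have hCr0 : 0 ≤ Cr := NNReal.coe_nonneg _
  set K₂ : ℝ := 5 * |γ| + 4 * a with hK₂
  have hK₂0 : 0 ≤ K₂ := by positivity
  set α₀ : ℝ := κ * |1 - γ| / ε with hα₀
  have hα₀0 : 0 ≤ α₀ := by positivity
  set β₀ : ℝ := κ * K₂ / ε + 2 * κ' / a with hβ₀
  have hβ₀0 : 0 ≤ β₀ := by positivity
  set G₁ : ℝ := 2 * α₀ ^ 2 * (cA * 5 ^ (1 - 2 * ρ)) + 2 * β₀ ^ 2 * (cE * 5 ^ (1 - ρ)) with hG₁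
  have hG₁0 : 0 ≤ G₁ := by positivity
  have hε4 : 0 < (ε / 4) ^ (3 / 2 : ℝ) := Real.rpow_pos_of_pos (by positivity) _
  set N₁ : ℝ := (CD : ℝ) * (5 : ℝ) ^ (2 - 2 * ρ) * ((ε / 4) ^ (3 / 2 : ℝ))⁻¹ with hN₁
  have hN₁0 : 0 ≤ N₁ := by positivity
  set KX : ℝ := 2 * G₁ + 2 * (M ^ 2 * N₁) with hKX
  have hKX0 : 0 ≤ KX := by positivity
  set L₀ : ℝ := max (max 1 L₁) (2 * Real.sqrt (|c₀| / ε)) with hL₀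
  refine ⟨Cr ^ 6 * KX ^ 3, L₀, by positivity, le_max_left _ _, fun L hL => ?_⟩
  have hL1 : 1 ≤ L := ((le_max_left _ _).trans (le_max_left _ _)).trans hL
  have hLL₁ : L₁ ≤ 5 * L := by
    have h1 : L₁ ≤ L := ((le_max_right _ _).trans (le_max_left _ _)).trans hL
    linarith
  have hL0 : 0 < L := one_pos.trans_le hL1
  have h5L : 0 < 5 * L := by positivity
  have hc₀L : |c₀| ≤ ε * L ^ 2 / 4 := by
    have h1 : 2 * Real.sqrt (|c₀| / ε) ≤ L := (le_max_right _ _).trans hL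
    have h2 : 0 ≤ Real.sqrt (|c₀| / ε) := Real.sqrt_nonneg _
    have h3 : Real.sqrt (|c₀| / ε) ^ 2 = |c₀| / ε := Real.sq_sqrt (by positivity)
    have h4 : 4 * (|c₀| / ε) ≤ L ^ 2 := by nlinarith
    have h5 : |c₀| / ε ≤ L ^ 2 / 4 := by linarith
    rw [div_le_iff₀ hε] at h5
    linarith
  have hE' := hE (5 * L) h5L
  have hA' := hA (5 * L) h5L
  -- ### the cutoff, the velocity cutoff and the truncation
  obtain ⟨χ, hχ1, hχc, h0, h1, hone, hzero, hdχ⟩ := hcut L hL0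
  set s : ℝ := ε * L ^ 2 with hs
  have hs0 : 0 < s := by positivity
  have hcheb := volume_absPressureHigh_inter_ball_le_of_growth (ρ := ρ) hQm hD (by positivity : 0 < s / 4) hLL₁
  set ℓ : ℝ := 2 * a * L with hℓ
  have hℓ0 : 0 < ℓ := by positivity
  set Φ : EuclideanSpace ℝ (Fin 3) → ℝ := fun y => φ ((ℓ ^ 2)⁻¹ * ‖U y‖ ^ 2) with hΦ
  have hΦ1 : ContDiff ℝ 1 Φ := hφ1.comp (contDiff_const.mul (hU1.norm_sq ℝ))
  set g : EuclideanSpace ℝ (Fin 3) → ℝ := fun y => ψ (s⁻¹ • P y) with hg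
  have hPs : ContDiff ℝ 1 (fun y => s⁻¹ • P y) := hPc.const_smul s⁻¹
  have hg1 : ContDiff ℝ 1 g := hψ1.comp hPs
  set f : EuclideanSpace ℝ (Fin 3) → ℝ := fun y => Φ y * g y with hf
  have hf1 : ContDiff ℝ 1 f := hΦ1.mul hg1
  have hg_one : ∀ y : EuclideanSpace ℝ (Fin 3), L ≤ ‖y‖ → ε * ‖y‖ ^ 2 < P y → g y = 1 := by
    intro y hyL hyP
    apply hψone
    have h2 : ε * L ^ 2 ≤ ε * ‖y‖ ^ 2 := mul_le_mul_of_nonneg_left (pow_le_pow_left₀ hL0.le hyL 2) hε.le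
    rw [smul_eq_mul, inv_mul_eq_div, le_div_iff₀ hs0, one_mul]
    linarith
  have hg_supp : ∀ y : EuclideanSpace ℝ (Fin 3), g y ≠ 0 → s / 2 < P y := by
    intro y hy
    by_contra hle
    push Not at hle
    refine hy (hψzero _ ?_)
    rw [smul_eq_mul, inv_mul_eq_div, div_le_iff₀ hs0]
    linarith
  have hΦ_one : ∀ y : EuclideanSpace ℝ (Fin 3), ‖y‖ ≤ 2 * L → ‖U y‖ < a * ‖y‖ → Φ y = 1 := by
    intro y hy2 hyU
    have hUℓ : ‖U y‖ ≤ ℓ := by rw [hℓ]; nlinarith [ha]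
    exact velocityCutoff_eq_one hφone hℓ0 hUℓ
  have hf_one : ∀ y : EuclideanSpace ℝ (Fin 3), L ≤ ‖y‖ → ‖y‖ ≤ 2 * L → ‖U y‖ < a * ‖y‖ → ε * ‖y‖ ^ 2 < P y → f y = 1 := by
    intro y hyL hy2 hyU hyP
    show Φ y * g y = 1
    rw [hΦ_one y hy2 hyU, hg_one y hyL hyP, one_mul]
  have hf_abs : ∀ y : EuclideanSpace ℝ (Fin 3), |f y| ≤ 1 := fun y => by
    show |Φ y * g y| ≤ 1
    rw [abs_mul, abs_of_nonneg (hφ0 _), abs_of_nonneg (hψ0 _)]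
    exact mul_le_one₀ (hφle _) (hψ0 _) (hψle _)
  have hf_supp : ∀ y : EuclideanSpace ℝ (Fin 3), f y ≠ 0 → s / 2 < P y := fun y hy =>
    hg_supp y (right_ne_zero_of_mul hy)
  -- ### pointwise gradient bound (the double truncation; `…SqueezeSobolevFreeTools`)
  set α : ℝ := α₀ / L ^ 2 with hαdef
  set β : ℝ := β₀ / L with hβdef
  have hα0 : 0 ≤ α := by positivity
  have hβ0 : 0 ≤ β := by positivity
  have hsα : κ * s⁻¹ * |1 - γ| = α := by
    rw [hαdef, hα₀, hs]
    field_simp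
  have hsβ : κ * s⁻¹ * (|γ| * (5 * L) + 2 * ℓ) + 4 * κ' / ℓ = β := by
    rw [hβdef, hβ₀, hs, hℓ, hK₂]
    field_simp
    ring
  have hfd_pt : ∀ y ∈ ball (0 : EuclideanSpace ℝ (Fin 3)) (5 * L), ‖fderiv ℝ f y‖ ≤ α * ‖U y‖ + β * ‖fderiv ℝ U y‖ := by
    intro y hy
    rw [mem_ball_zero_iff] at hy
    have h1 := norm_fderiv_doubleTruncation_le hprof hφ1 hφ0 hφle hφzero hκ'0 hdφ hdφz hψ1 hψ0 hψle hdψ hs0 hℓ0 hy.le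
    rw [hsα, hsβ] at h1
    exact h1
  have hI6 := lintegral_pow_six_le_of_cutoff_real hf1 hχ1 hχc h1 h0 hL0 hone hzero hdχ
  -- ### the left-hand side dominates the volume of the target set
  set T : Set (EuclideanSpace ℝ (Fin 3)) :=
    {y | ‖U y‖ < a * ‖y‖ ∧ ε * ‖y‖ ^ 2 < P y} ∩ {y | L ≤ ‖y‖ ∧ ‖y‖ ≤ 2 * L} with hT
  have hTmeas : MeasurableSet T :=
    ((isOpen_lt hUcont.norm (continuous_const.mul continuous_norm)).inter
      (isOpen_lt (continuous_const.mul (continuous_norm.pow 2)) hPcont)).measurableSet.inter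
      ((isClosed_le continuous_const continuous_norm).inter (isClosed_le continuous_norm continuous_const)).measurableSet
  have hvolT : volume T ≤ ∫⁻ y in closedBall (0 : EuclideanSpace ℝ (Fin 3)) (2 * L), ‖f y‖ₑ ^ 6 := by
    calc volume T = ∫⁻ _ in T, 1 := (setLIntegral_one T).symm
      _ = ∫⁻ y in T, ‖f y‖ₑ ^ 6 := by
          refine setLIntegral_congr_fun hTmeas (fun y hy => ?_)
          obtain ⟨⟨hyU, hyP⟩, hyL, hy2⟩ := hy
          rw [hf_one y hyL hy2 hyU hyP]
          simp
      _ ≤ ∫⁻ y in closedBall (0 : EuclideanSpace ℝ (Fin 3)) (2 * L), ‖f y‖ₑ ^ 6 := by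
          refine lintegral_mono_set fun y hy => ?_
          rw [mem_closedBall, dist_zero_right]
          exact hy.2.2
  -- ### the gradient term
  have hmeasU : Measurable fun y => 2 * ENNReal.ofReal (α ^ 2) * ‖U y‖ₑ ^ 2 :=
    (hUcont.measurable.enorm.pow_const 2).const_mul _
  have hIgradf : ∫⁻ y in ball (0 : EuclideanSpace ℝ (Fin 3)) (5 * L), ‖fderiv ℝ f y‖ₑ ^ 2 ≤
      2 * ENNReal.ofReal (α ^ 2) * (∫⁻ y in ball (0 : EuclideanSpace ℝ (Fin 3)) (5 * L), ‖U y‖ₑ ^ 2) +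
        2 * ENNReal.ofReal (β ^ 2) * ∫⁻ y in ball (0 : EuclideanSpace ℝ (Fin 3)) (5 * L), ‖fderiv ℝ U y‖ₑ ^ 2 := by
    have hpt : ∀ y ∈ ball (0 : EuclideanSpace ℝ (Fin 3)) (5 * L), ‖fderiv ℝ f y‖ₑ ^ 2 ≤
        2 * ENNReal.ofReal (α ^ 2) * ‖U y‖ₑ ^ 2 + 2 * ENNReal.ofReal (β ^ 2) * ‖fderiv ℝ U y‖ₑ ^ 2 := by
      intro y hy
      have h1 := hfd_pt y hy
      have hsq : ‖fderiv ℝ f y‖ ^ 2 ≤ 2 * α ^ 2 * ‖U y‖ ^ 2 + 2 * β ^ 2 * ‖fderiv ℝ U y‖ ^ 2 := by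
        have h2 : 0 ≤ α * ‖U y‖ + β * ‖fderiv ℝ U y‖ := by positivity
        calc ‖fderiv ℝ f y‖ ^ 2 ≤ (α * ‖U y‖ + β * ‖fderiv ℝ U y‖) ^ 2 := pow_le_pow_left₀ (norm_nonneg _) h1 2
          _ ≤ 2 * (α * ‖U y‖) ^ 2 + 2 * (β * ‖fderiv ℝ U y‖) ^ 2 := by
              nlinarith [sq_nonneg (α * ‖U y‖ - β * ‖fderiv ℝ U y‖)]
          _ = 2 * α ^ 2 * ‖U y‖ ^ 2 + 2 * β ^ 2 * ‖fderiv ℝ U y‖ ^ 2 := by ring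
      have e1 : ‖fderiv ℝ f y‖ₑ ^ 2 = ENNReal.ofReal (‖fderiv ℝ f y‖ ^ 2) := by
        rw [← ofReal_norm, ENNReal.ofReal_pow (norm_nonneg _)]
      have e2 : ‖U y‖ₑ ^ 2 = ENNReal.ofReal (‖U y‖ ^ 2) := by
        rw [← ofReal_norm, ENNReal.ofReal_pow (norm_nonneg _)]
      have e3 : ‖fderiv ℝ U y‖ₑ ^ 2 = ENNReal.ofReal (‖fderiv ℝ U y‖ ^ 2) := by
        rw [← ofReal_norm, ENNReal.ofReal_pow (norm_nonneg _)]
      rw [e1, e2, e3]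
      calc ENNReal.ofReal (‖fderiv ℝ f y‖ ^ 2)
          ≤ ENNReal.ofReal (2 * α ^ 2 * ‖U y‖ ^ 2 + 2 * β ^ 2 * ‖fderiv ℝ U y‖ ^ 2) := ENNReal.ofReal_le_ofReal hsq
        _ = 2 * ENNReal.ofReal (α ^ 2) * ENNReal.ofReal (‖U y‖ ^ 2) +
              2 * ENNReal.ofReal (β ^ 2) * ENNReal.ofReal (‖fderiv ℝ U y‖ ^ 2) := by
            rw [ENNReal.ofReal_add (by positivity) (by positivity), ENNReal.ofReal_mul (by positivity),
              ENNReal.ofReal_mul (by norm_num), ENNReal.ofReal_mul (by positivity), ENNReal.ofReal_mul (by norm_num),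
              ENNReal.ofReal_ofNat]
    calc ∫⁻ y in ball (0 : EuclideanSpace ℝ (Fin 3)) (5 * L), ‖fderiv ℝ f y‖ₑ ^ 2
        ≤ ∫⁻ y in ball (0 : EuclideanSpace ℝ (Fin 3)) (5 * L),
            (2 * ENNReal.ofReal (α ^ 2) * ‖U y‖ₑ ^ 2 + 2 * ENNReal.ofReal (β ^ 2) * ‖fderiv ℝ U y‖ₑ ^ 2) :=
          lintegral_mono_ae ((ae_restrict_iff' measurableSet_ball).2 (Eventually.of_forall hpt))
      _ = 2 * ENNReal.ofReal (α ^ 2) * (∫⁻ y in ball (0 : EuclideanSpace ℝ (Fin 3)) (5 * L), ‖U y‖ₑ ^ 2) +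
            2 * ENNReal.ofReal (β ^ 2) * ∫⁻ y in ball (0 : EuclideanSpace ℝ (Fin 3)) (5 * L), ‖fderiv ℝ U y‖ₑ ^ 2 := by
          rw [lintegral_add_left' hmeasU.aemeasurable,
            lintegral_const_mul' _ _ (ENNReal.mul_ne_top ENNReal.ofNat_ne_top ENNReal.ofReal_ne_top),
            lintegral_const_mul' _ _ (ENNReal.mul_ne_top ENNReal.ofNat_ne_top ENNReal.ofReal_ne_top)]
  -- ### the support term
  set S₁ : Set (EuclideanSpace ℝ (Fin 3)) := {y | s / 2 < P y} with hS₁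
  have hS₁m : MeasurableSet S₁ := (isOpen_lt continuous_const hPcont).measurableSet
  have hIf2 : ∫⁻ y in ball (0 : EuclideanSpace ℝ (Fin 3)) (5 * L), ‖f y‖ₑ ^ 2 ≤
      volume (S₁ ∩ ball (0 : EuclideanSpace ℝ (Fin 3)) (5 * L)) := by
    calc ∫⁻ y in ball (0 : EuclideanSpace ℝ (Fin 3)) (5 * L), ‖f y‖ₑ ^ 2
        ≤ ∫⁻ y in ball (0 : EuclideanSpace ℝ (Fin 3)) (5 * L), S₁.indicator 1 y := by
          refine lintegral_mono fun y => ?_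
          by_cases hy : y ∈ S₁
          · rw [indicator_of_mem hy, Pi.one_apply, ← ofReal_norm, ← ENNReal.ofReal_pow (norm_nonneg _)]
            refine ENNReal.ofReal_le_one.2 ?_
            rw [Real.norm_eq_abs]
            exact pow_le_one₀ (abs_nonneg _) (hf_abs _)
          · have hfy : f y = 0 := by
              by_contra hne
              exact hy (hf_supp y hne)
            rw [hfy]
            simp
      _ = volume (S₁ ∩ ball (0 : EuclideanSpace ℝ (Fin 3)) (5 * L)) := by
          rw [lintegral_indicator_one hS₁m, Measure.restrict_apply hS₁m]
  have hS₁S₂ : volume (S₁ ∩ ball (0 : EuclideanSpace ℝ (Fin 3)) (5 * L)) ≤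
      volume ({y : EuclideanSpace ℝ (Fin 3) | s / 4 ≤ ‖Q y‖} ∩ ball (0 : EuclideanSpace ℝ (Fin 3)) (5 * L)) := by
    refine measure_mono_ae ?_
    filter_upwards [hc₀] with y hy
    rintro ⟨hyS, hyB⟩
    refine ⟨?_, hyB⟩
    have hyS' : s / 2 < P y := hyS
    show s / 4 ≤ ‖Q y‖
    rw [hy, Real.norm_eq_abs]
    have hc : -(s / 4) ≤ c₀ := by
      have hs4 : |c₀| ≤ s / 4 := by rw [hs]; exact hc₀L
      linarith [neg_abs_le c₀]
    exact le_trans (by linarith) (le_abs_self _)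
  -- ### abbreviations and the assembled `ℝ≥0∞` bound
  set A' : ℝ := cA * (5 * L) ^ (1 - 2 * ρ) with hA'def
  set E' : ℝ := cE * (5 * L) ^ (1 - ρ) with hE'def
  set G : ℝ := 2 * α ^ 2 * A' + 2 * β ^ 2 * E' with hGdef
  set N' : ℝ := (CD : ℝ) * (5 * L) ^ (2 - 2 * ρ) / (s / 4) ^ (3 / 2 : ℝ) with hN'
  set m2 : ℝ := (M / L) ^ 2 with hm2
  set X : ℝ := 2 * G + 2 * m2 * N' with hX
  have hA'0 : 0 ≤ A' := by positivity
  have hE'0 : 0 ≤ E' := by positivity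
  have hG0 : 0 ≤ G := by positivity
  have hs4pos : 0 < (s / 4) ^ (3 / 2 : ℝ) := Real.rpow_pos_of_pos (by positivity) _
  have hN'0 : 0 ≤ N' := div_nonneg (mul_nonneg hCD0 (Real.rpow_nonneg h5L.le _)) hs4pos.le
  have hm20 : 0 ≤ m2 := by positivity
  have hX0 : 0 ≤ X := by positivity
  have hofG : ENNReal.ofReal G =
      2 * ENNReal.ofReal (α ^ 2) * ENNReal.ofReal A' + 2 * ENNReal.ofReal (β ^ 2) * ENNReal.ofReal E' := by
    rw [hGdef, ENNReal.ofReal_add (by positivity) (by positivity),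
      ENNReal.ofReal_mul (by positivity : (0 : ℝ) ≤ 2 * α ^ 2), ENNReal.ofReal_mul (by norm_num : (0 : ℝ) ≤ 2),
      ENNReal.ofReal_mul (by positivity : (0 : ℝ) ≤ 2 * β ^ 2), ENNReal.ofReal_mul (by norm_num : (0 : ℝ) ≤ 2),
      ENNReal.ofReal_ofNat]
  have hIgradf' : ∫⁻ y in ball (0 : EuclideanSpace ℝ (Fin 3)) (5 * L), ‖fderiv ℝ f y‖ₑ ^ 2 ≤ ENNReal.ofReal G := by
    refine hIgradf.trans ?_
    rw [hofG]
    gcongr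
  have hIf2' : ∫⁻ y in ball (0 : EuclideanSpace ℝ (Fin 3)) (5 * L), ‖f y‖ₑ ^ 2 ≤ ENNReal.ofReal N' :=
    hIf2.trans (hS₁S₂.trans hcheb)
  have hofX : ENNReal.ofReal X = 2 * ENNReal.ofReal G + 2 * ENNReal.ofReal m2 * ENNReal.ofReal N' := by
    rw [hX, ENNReal.ofReal_add (by positivity) (by positivity), ENNReal.ofReal_mul (by norm_num : (0 : ℝ) ≤ 2),
      ENNReal.ofReal_mul (by positivity : (0 : ℝ) ≤ 2 * m2), ENNReal.ofReal_mul (by norm_num : (0 : ℝ) ≤ 2),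
      ENNReal.ofReal_ofNat]
  have hmain : volume T ≤ ENNReal.ofReal (Cr ^ 6 * X ^ 3) := by
    refine hvolT.trans (hI6.trans ?_)
    calc (eLpNormLESNormFDerivOfEqInnerConst (volume : Measure (EuclideanSpace ℝ (Fin 3))) 2 : ℝ≥0∞) ^ 6 *
          ((2 * ∫⁻ y in ball (0 : EuclideanSpace ℝ (Fin 3)) (5 * L), ‖fderiv ℝ f y‖ₑ ^ 2) +
            2 * ENNReal.ofReal ((M / L) ^ 2) * ∫⁻ y in ball (0 : EuclideanSpace ℝ (Fin 3)) (5 * L), ‖f y‖ₑ ^ 2) ^ 3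
        ≤ (eLpNormLESNormFDerivOfEqInnerConst (volume : Measure (EuclideanSpace ℝ (Fin 3))) 2 : ℝ≥0∞) ^ 6 *
          (2 * ENNReal.ofReal G + 2 * ENNReal.ofReal m2 * ENNReal.ofReal N') ^ 3 := by gcongr
      _ = ENNReal.ofReal (Cr ^ 6 * X ^ 3) := by
          rw [← hofX, ← ENNReal.ofReal_pow hX0, hCr, ← ENNReal.ofReal_coe_nnreal, ← ENNReal.ofReal_pow (NNReal.coe_nonneg _),
            ← ENNReal.ofReal_mul (by positivity)]
  refine hmain.trans (ENNReal.ofReal_le_ofReal ?_)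
  -- ### real bookkeeping: `X ≤ KX · L^{−1−ρ}`
  have e1 : A' = cA * 5 ^ (1 - 2 * ρ) * L ^ (1 - 2 * ρ) := by
    rw [hA'def, Real.mul_rpow (by norm_num) hL0.le, mul_assoc]
  have e2 : E' = cE * 5 ^ (1 - ρ) * L ^ (1 - ρ) := by
    rw [hE'def, Real.mul_rpow (by norm_num) hL0.le, mul_assoc]
  have hL2 : L ^ 2 = L ^ (2 : ℝ) := (Real.rpow_two L).symm
  have hαA : α ^ 2 * A' ≤ α₀ ^ 2 * (cA * 5 ^ (1 - 2 * ρ)) * L ^ (-1 - ρ) := by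
    have hL4 : (L ^ 2) ^ 2 = L ^ (4 : ℝ) := by
      rw [hL2, ← Real.rpow_natCast, ← Real.rpow_mul hL0.le]
      norm_num
    have h14 : L ^ (1 - 2 * ρ) / L ^ (4 : ℝ) = L ^ (-3 - 2 * ρ) := by
      rw [← Real.rpow_sub hL0]
      ring_nf
    have hLe : L ^ (-3 - 2 * ρ) ≤ L ^ (-1 - ρ) := Real.rpow_le_rpow_of_exponent_le hL1 (by linarith)
    have hL4pos : 0 < L ^ (4 : ℝ) := Real.rpow_pos_of_pos hL0 _
    calc α ^ 2 * A' = α₀ ^ 2 * (cA * 5 ^ (1 - 2 * ρ)) * (L ^ (1 - 2 * ρ) / L ^ (4 : ℝ)) := by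
          rw [hαdef, e1, div_pow, hL4]
          field_simp
      _ = α₀ ^ 2 * (cA * 5 ^ (1 - 2 * ρ)) * L ^ (-3 - 2 * ρ) := by rw [h14]
      _ ≤ α₀ ^ 2 * (cA * 5 ^ (1 - 2 * ρ)) * L ^ (-1 - ρ) := mul_le_mul_of_nonneg_left hLe (by positivity)
  have hβE : β ^ 2 * E' = β₀ ^ 2 * (cE * 5 ^ (1 - ρ)) * L ^ (-1 - ρ) := by
    have h13 : L ^ (1 - ρ) / L ^ (2 : ℝ) = L ^ (-1 - ρ) := by
      rw [← Real.rpow_sub hL0]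
      ring_nf
    have hL2pos : 0 < L ^ (2 : ℝ) := Real.rpow_pos_of_pos hL0 _
    calc β ^ 2 * E' = β₀ ^ 2 * (cE * 5 ^ (1 - ρ)) * (L ^ (1 - ρ) / L ^ (2 : ℝ)) := by
          rw [hβdef, e2, div_pow, hL2]
          field_simp
      _ = β₀ ^ 2 * (cE * 5 ^ (1 - ρ)) * L ^ (-1 - ρ) := by rw [h13]
  have hGle : G ≤ G₁ * L ^ (-1 - ρ) := by
    calc G = 2 * (α ^ 2 * A') + 2 * (β ^ 2 * E') := by rw [hGdef]; ring
      _ ≤ 2 * (α₀ ^ 2 * (cA * 5 ^ (1 - 2 * ρ)) * L ^ (-1 - ρ)) + 2 * (β₀ ^ 2 * (cE * 5 ^ (1 - ρ)) * L ^ (-1 - ρ)) := by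
          rw [hβE]
          gcongr
      _ = G₁ * L ^ (-1 - ρ) := by rw [hG₁]; ring
  have e3 : (s / 4) ^ (3 / 2 : ℝ) = (ε / 4) ^ (3 / 2 : ℝ) * L ^ (3 : ℝ) := by
    rw [hs, show ε * L ^ 2 / 4 = (ε / 4) * L ^ 2 by ring, Real.mul_rpow (by positivity) (by positivity), hL2,
      ← Real.rpow_mul hL0.le]
    norm_num
  have e4 : (5 * L) ^ (2 - 2 * ρ) = 5 ^ (2 - 2 * ρ) * L ^ (2 - 2 * ρ) := Real.mul_rpow (by norm_num) hL0.le
  have hε40 : (ε / 4) ^ (3 / 2 : ℝ) ≠ 0 := hε4.ne'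
  have hL30 : L ^ (3 : ℝ) ≠ 0 := (Real.rpow_pos_of_pos hL0 _).ne'
  have hN'eq : N' = N₁ * L ^ (-(1 + 2 * ρ)) := by
    have h12 : L ^ (2 - 2 * ρ) / L ^ (3 : ℝ) = L ^ (-(1 + 2 * ρ)) := by
      rw [← Real.rpow_sub hL0]
      ring_nf
    rw [hN', e3, e4, hN₁]
    calc (CD : ℝ) * (5 ^ (2 - 2 * ρ) * L ^ (2 - 2 * ρ)) / ((ε / 4) ^ (3 / 2 : ℝ) * L ^ (3 : ℝ))
        = (CD : ℝ) * 5 ^ (2 - 2 * ρ) * ((ε / 4) ^ (3 / 2 : ℝ))⁻¹ * (L ^ (2 - 2 * ρ) / L ^ (3 : ℝ)) := by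
          field_simp
      _ = (CD : ℝ) * 5 ^ (2 - 2 * ρ) * ((ε / 4) ^ (3 / 2 : ℝ))⁻¹ * L ^ (-(1 + 2 * ρ)) := by rw [h12]
  have hm2eq : m2 = M ^ 2 * L ^ (-2 : ℝ) := by
    rw [hm2, div_pow, Real.rpow_neg hL0.le, hL2, div_eq_mul_inv]
  have hm2N : m2 * N' = M ^ 2 * N₁ * L ^ (-3 - 2 * ρ) := by
    have h13 : L ^ (-2 : ℝ) * L ^ (-(1 + 2 * ρ)) = L ^ (-3 - 2 * ρ) := by
      rw [← Real.rpow_add hL0]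
      ring_nf
    rw [hm2eq, hN'eq]
    calc M ^ 2 * L ^ (-2 : ℝ) * (N₁ * L ^ (-(1 + 2 * ρ))) = M ^ 2 * N₁ * (L ^ (-2 : ℝ) * L ^ (-(1 + 2 * ρ))) := by ring
      _ = M ^ 2 * N₁ * L ^ (-3 - 2 * ρ) := by rw [h13]
  have hterm2 : 2 * m2 * N' ≤ 2 * (M ^ 2 * N₁) * L ^ (-1 - ρ) := by
    have hLe : L ^ (-3 - 2 * ρ) ≤ L ^ (-1 - ρ) := Real.rpow_le_rpow_of_exponent_le hL1 (by linarith)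
    calc 2 * m2 * N' = 2 * (M ^ 2 * N₁) * L ^ (-3 - 2 * ρ) := by rw [mul_assoc, hm2N]; ring
      _ ≤ 2 * (M ^ 2 * N₁) * L ^ (-1 - ρ) := mul_le_mul_of_nonneg_left hLe (by positivity)
  have hXK : X ≤ KX * L ^ (-1 - ρ) := by
    calc X = 2 * G + 2 * m2 * N' := hX
      _ ≤ 2 * (G₁ * L ^ (-1 - ρ)) + 2 * (M ^ 2 * N₁) * L ^ (-1 - ρ) := add_le_add (by gcongr) hterm2
      _ = KX * L ^ (-1 - ρ) := by rw [hKX]; ring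
  have hp3 : (L ^ (-1 - ρ)) ^ 3 = L ^ (-3 - 3 * ρ) := by
    rw [← Real.rpow_natCast, ← Real.rpow_mul hL0.le]
    norm_num
    ring_nf
  clear_value α β G N' m2 X
  calc Cr ^ 6 * X ^ 3 ≤ Cr ^ 6 * (KX * L ^ (-1 - ρ)) ^ 3 :=
        mul_le_mul_of_nonneg_left (pow_le_pow_left₀ hX0 hXK 3) (pow_nonneg hCr0 6)
    _ = Cr ^ 6 * KX ^ 3 * L ^ (-3 - 3 * ρ) := by rw [mul_pow, hp3]; ring

/-- **THE SLOW PRESSURISED SET IS SOBOLEV-THIN FAR OUT — no growth hypothesis**: under the hypotheses of `Loc.volume_slowPressureHigh_inter_shell_le_sobolev` and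
`ρ > −1` there are `K′ ≥ 0`, `L₀ ≥ max 1 L₁` with `vol({‖U y‖ < a‖y‖ ∧ ε‖y‖² < P y} ∩ {R ≤ ‖y‖}) ≤ K′ R^{−3−3ρ}` for all `R ≥ L₀` (dyadic tail
`Loc.volume_inter_far_le_of_shell`). [folklore; Gagliardo–Nirenberg–Sobolev inequality] -/
theorem volume_slowPressureHigh_inter_far_le_sobolev {ρ : ℝ} (hρ0 : -1 < ρ)
    (hprof : IsSelfSimilarEulerProfile γ 0 U P)
    {cA cE : ℝ} (hcA : 0 ≤ cA) (hcE : 0 ≤ cE)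
    (hA : ∀ L : ℝ, 0 < L → ∫⁻ y in ball (0 : EuclideanSpace ℝ (Fin 3)) L, ‖U y‖ₑ ^ 2 ≤ ENNReal.ofReal (cA * L ^ (1 - 2 * ρ)))
    (hE : ∀ L : ℝ, 0 < L → ∫⁻ y in ball (0 : EuclideanSpace ℝ (Fin 3)) L, ‖fderiv ℝ U y‖ₑ ^ 2 ≤
      ENNReal.ofReal (cE * L ^ (1 - ρ)))
    {Q : EuclideanSpace ℝ (Fin 3) → ℝ} (hQm : AEStronglyMeasurable Q volume) {CD : ℝ≥0} {L₁ : ℝ}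
    (hD : ∀ R : ℝ, L₁ ≤ R → ∫⁻ y in ball (0 : EuclideanSpace ℝ (Fin 3)) R, ‖Q y‖ₑ ^ (3 / 2 : ℝ) ≤
      CD * ENNReal.ofReal (R ^ (2 - 2 * ρ)))
    {c₀ : ℝ} (hc₀ : Q =ᵐ[volume] fun y => P y + c₀) {ε : ℝ} (hε : 0 < ε) {a : ℝ} (ha : 0 < a) :
    ∃ K' L₀ : ℝ, 0 ≤ K' ∧ max 1 L₁ ≤ L₀ ∧ ∀ R : ℝ, L₀ ≤ R →
      volume ({y : EuclideanSpace ℝ (Fin 3) | ‖U y‖ < a * ‖y‖ ∧ ε * ‖y‖ ^ 2 < P y} ∩ {y | R ≤ ‖y‖}) ≤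
        ENNReal.ofReal (K' * R ^ (-3 - 3 * ρ)) := by
  obtain ⟨K, L₀, hK0, hL₀, hshell⟩ :=
    volume_slowPressureHigh_inter_shell_le_sobolev (by linarith) hprof hcA hcE hA hE hQm hD hc₀ hε ha
  have hs : (-3 - 3 * ρ : ℝ) < 0 := by linarith
  have hL₀1 : 1 ≤ L₀ := (le_max_left _ _).trans hL₀
  refine ⟨|K| * (1 - (2 : ℝ) ^ (-3 - 3 * ρ))⁻¹, L₀, ?_, hL₀, fun R hR =>
    volume_inter_far_le_of_shell _ (one_pos.trans_le hL₀1) hs hshell hR⟩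
  have h2s1 : (2 : ℝ) ^ (-3 - 3 * ρ) < 1 := Real.rpow_lt_one_of_one_lt_of_neg (by norm_num) hs
  have : 0 < (1 - (2 : ℝ) ^ (-3 - 3 * ρ))⁻¹ := inv_pos.2 (by linarith)
  positivity

end Summit.NavierStokesRegularity.NavierStokesRegularity.Theorems.PowerGaugeEulerLiouville.Loc

end
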